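import Summits.Ventures.PercRepro.MSTightUniqueNonFace

/-!
# (S1) and the lift with complements inside `u` (ground-free forms of MSTightAnatomy.lean and
# MSTightTraces.lean)

Dossier proofs/MINE1-theoremS.md, Addendum 38 §3 (S1) and Addendum 39 Step 3, and
proofs/MINE1-RSTARM-PROOF.md §3 (S1), §6. The tree's `mem_of_mem_of_ne_of_noWitness`
(MSTightAnatomy.lean) and `exists_mem_inter_of_trace_sdiff_mem` (MSTightTraces.lean) take the
up-set `U` with `univ ∖ y ∈ L'` for its members; both use this only to know `u ∖ y ∈ L'` for the
members of `U` inside `u`. For instances on a ground set `S ≠ univ` (MSTightInstance.lean) the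
members of `U` have `S ∖ y ∈ L'`, so the two statements are restated here with the hypothesis
`u ∖ y ∈ L'` for `y ∈ U`, `y ⊆ u` — which is all the proofs need:
* **(S1)** `mem_of_mem_of_ne_of_noWitness_of_sdiff_mem`: in a witness-free instance every member
  of `U` strictly inside `u` is a member of `T` (the unique-non-face lemma (U1) + `T = U ∩ ↓T`);
* **the lift** `exists_mem_inter_of_trace_sdiff_mem_of_sdiff_mem`: a trace `y ∩ u` of a member
  `y` (with `u ∖ y ∈ L'`) such that `u ∖ (y ∩ u) ∈ U` is, under (S1), the witness `u ∖ (y ∩ u)`.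
-/

namespace PercRepro.MSTight

open Finset

variable {α : Type*} [DecidableEq α]

/-- **(S1), ground-free form.** In a witness-free instance every member of `U` strictly inside
`u` is a member of `T`. -/
theorem mem_of_mem_of_ne_of_noWitness_of_sdiff_mem {L' U T C : Finset (Finset α)} {u : Finset α}
    (hL : ∀ w ∈ L', ∀ w', w' ⊆ w → w' ∈ L') (hU : ∀ y ∈ U, y ⊆ u → u \ y ∈ L')
    (hC : ∀ x ∈ C, ∃ t ∈ T, x ⊆ t) (hF2 : ∀ y ∈ U, (∃ t ∈ T, y ⊆ t) → y ∈ T)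
    (hnw : ∀ t ∈ T, t ∉ L') (hmin : ∀ y ∈ U, y ⊆ u → ∃ z ∈ T, z ⊆ y)
    (hempty : ∅ ∈ L') (hu : u ∉ L') (huC : u ∉ C)
    (hSig : ∀ x ∈ L', x ⊆ u → u \ x ∉ L' → x ∈ C)
    (hcount : ((L'.filter fun w => w ⊆ u) ∩ (C.filter fun w => w ⊆ u)).card
      = (complWithin u (L'.filter fun w => w ⊆ u) ∩ (C.filter fun w => w ⊆ u)).card + 1)
    {y : Finset α} (hyU : y ∈ U) (hyu : y ⊆ u) (hyne : y ≠ u) : y ∈ T := by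
  have hyL : y ∉ L' := by
    intro hyL
    obtain ⟨z, hzT, hzy⟩ := hmin y hyU hyu
    exact hnw z hzT (hL y hyL z hzy)
  have hcomp : u \ y ∈ L' := hU y hyU hyu
  have hyC : y ∈ C := by
    by_contra hyC
    apply hyne
    refine eq_of_sdiff_mem_of_notMem (A := L'.filter fun w => w ⊆ u)
      (C := C.filter fun w => w ⊆ u) ?_ ?_ ?_ ?_ ?_ hcount hyu ?_ ?_ ?_
    · intro x hx
      exact (mem_filter.1 hx).2
    · exact mem_filter.2 ⟨hempty, empty_subset u⟩
    · intro h
      exact hu (mem_filter.1 h).1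
    · intro h
      exact huC (mem_filter.1 h).1
    · intro x hx hx'
      obtain ⟨hxL, hxu⟩ := mem_filter.1 hx
      refine mem_filter.2 ⟨hSig x hxL hxu ?_, hxu⟩
      intro hux
      exact hx' (mem_filter.2 ⟨hux, sdiff_subset⟩)
    · exact mem_filter.2 ⟨hcomp, sdiff_subset⟩
    · intro h
      exact hyL (mem_filter.1 h).1
    · intro h
      exact hyC (mem_filter.1 h).1
  exact hF2 y hyU (hC y hyC)

/-- **The lift, ground-free form.** If the trace `t = y ∩ u` of a set `y` with `u \ y ∈ L'` (a
member of `T`, in the instance) has `u \ t ∈ U` and every member of `U` strictly inside `u` is a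
member of `T` ((S1)), then `u \ t` is a witness. -/
theorem exists_mem_inter_of_trace_sdiff_mem_of_sdiff_mem {L' U T : Finset (Finset α)}
    {u y : Finset α} (hS1 : ∀ x ∈ U, x ⊆ u → x ≠ u → x ∈ T) (hyL : u \ y ∈ L')
    (hyu : (y ∩ u).Nonempty) (ht : u \ (y ∩ u) ∈ U) : ∃ w ∈ T, w ∈ L' := by
  refine ⟨u \ (y ∩ u), hS1 _ ht sdiff_subset ?_, ?_⟩
  · intro h
    obtain ⟨a, ha⟩ := hyu
    have : a ∈ u \ (y ∩ u) := by rw [h]; exact (mem_inter.1 ha).2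
    exact (mem_sdiff.1 this).2 ha
  · have : u \ (y ∩ u) = u \ y := by
      ext a; simp only [mem_sdiff, mem_inter]; tauto
    rw [this]; exact hyL

end PercRepro.MSTight
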